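import Summits.QuantumFields.YangMills.Theorems.UnitScaleTiltProp7LineAvgRightInverse
import HarnessLib

/-!
# Route `UnitScaleTilt`, crux K1 child «MinimiserStabilityRegPr» (stmt-QuantumFields-19200), registered stub `stub_prop7From14` (skeleton birth_v6
# 636b1fa3b005; leaf V3 «Prop 7 from a background (14)») — sub-lemma V3-C″ (the GRADIENT half of (46)), part 1/3: THE TRANSVERSALLY MODULATED
# TENT FIELD AND ITS NORMAL OPERATOR (unchanged: g3's axis-tridiagonal `T`)

Cell `ym3-torus` ∕ fleet seat `ym-ust-19200-p1` (gen 4).  WHERE THIS SITS.  [Balaban1985Variational] Sect. C (p. 285) builds the chart (47)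
`A = A′ − HD(A′)` on a right inverse `H` of the linearised averaging which is «an operator defined on configurations B and giving a minimum of the
quadratic form ½⟨A, ΔA⟩ under the restrictions L^jηQ_jA = B …» and therefore obeys BOTH bounds of (46): «|HB| ≤ B₀(L^jη)⁻¹|B|,
|∇HB| ≤ B₀(L^jη)⁻²|B|» ([Balaban1984PropagatorsII] Thm 3.12).  The predecessor files of this seat's lineage (`UnitScaleTiltProp7LineAvgTwoBlock`,
`…Tridiagonal`, `…RightInverse`, gen 3) construct a `k`-uniform right inverse of the straight-line block average `M_k = LatticeFieldCalculus.bondAvgIter k`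
(tent interpolation ∘ inverse of the axis-tridiagonal normal operator `T`) with the FIRST bound of (46) only: the tent field is constant across each block
transversally to the bond's axis, so it jumps by an amount of the size of the field itself at transverse block faces and has no gradient bound of the
form `|∇HB| ≲ L^{−k}·max|B|`.  The `ℓ²` uniqueness route of the item (secant–tangent correction `Y ↦ Y − H(M_kY)`, p509106) needs exactly that bound
(the Dirichlet energy of the correction must be `O(L^{k(d−2)})·Σ|M_kY|²`, not `O(L^{k(d−1)})`).  REPAIR (this file and its two sequels): modulate the
tent field transversally by a «bubble» profile `ψ` of block mean `1` — for the concrete choice `ψ(s) = 6(s+1)(L^k − s)∕((L^k+1)(L^k+2))` of part 3,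
`0 ≤ ψ ≤ 2`, `|ψ(s+1) − ψ(s)| ≤ 6L^{−k}` and `ψ ≤ 6L^{−k}` at the two faces — so that the field becomes Lipschitz on the block scale in EVERY direction
while its straight-line block average is UNCHANGED: `M_k Z = T W` with gen 3's tridiagonal `T` verbatim (the transversal factor averages to `1` line by
line), hence gen 3's inverse `T⁻¹` and its `k`-uniform dominance constant are reused as they stand.

WHAT IS PROVED HERE (sorry-free, no definition; [folklore] finite sums).  `n = L^k`, `h : |T^{(0)}| = L^k·|T^{(k)}|` per direction.
* §1 `sum_offsets_mul_prod_erase`: `Σ_{r ∈ [0,n)^d} f(r_μ)·Π_{ν≠μ} φ(r_ν) = (Σ_s f(s))·(Σ_s φ(s))^{d−1}` (separable sums over block offsets).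
* §2 the modulated field `Z` of a coarse bond field `W` (hypothesis `hZ`: `Z(b) = (L^{kd}L^k)⁻¹((s_b+1)W(ȳ_b) + (L^k−1−s_b)W(ȳ_b−e_μ))·Π_{ν≠μ}ψ(r_ν(b))`,
  `s_b` the axial offset, `r_ν(b)` the transversal offsets of `b₋` in its `k`-block `ȳ_b`), read on a block (`modField_fibreSite`), and
  **`lineAvg_modField`**: for ANY profile with `Σ_{s<n}ψ(s) = n`, `M_k Z (c) = (L^{kd}L^k)⁻²(L^k)^{d−1}(αW(c) + γW(c−e_μ) + γW(c+e_μ))` — literally the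
  right-hand side of gen 3's `lineAvg_adjField` (same tent moments `α`, `γ`).
* §3 block coordinates of a shifted fine site (for the gradient bounds of part 2): `eq_fibreSite_proj` (every fine site is an offset site of its own
  block), `fibreSite_shift_of_lt` (a unit step inside the block raises the offset), `fibreSite_shift_of_eq` (a unit step across the face advances the
  block and resets the offset).

WHAT THIS IS NOT.  Not print's `G`-weighted `H` (no Landau-type condition `RD^*HB = 0`), flat background and straight-line main term only; nothing of
Bałaban's is asserted.  Parts 2/3: the four bounds (sup, `ℓ²`, gradient-sup, gradient-`ℓ²`) and the assembled right inverse.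

References: T. Bałaban, CMP 102 (1985) 277–309 [Balaban1985Variational] ((45)–(47) p.285); CMP 96 (1984) 223–250 [Balaban1984PropagatorsII] (Thm 3.12).
-/

noncomputable section

open scoped BigOperators

namespace Summit.QuantumFields.YangMills.Theorems.Prop7LineAvgSmoothRightInverse

open Literature.MathematicalPhysics.QuantumFieldTheory.Balaban1983to89
open Finset LatticeFieldCalculus B1RG242Torus
open B10StarCount (sum_pbond shift_apply_self shift_apply_ne)
open Summit.QuantumFields.YangMills.Theorems.Prop7FlatCoercivity (iterate_shift_eq_runSite runSite_runSite runSite_apply_self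
  runSite_apply_of_ne fibreSite_runSite sum_fibre_eq_sum_offsets)
open Summit.QuantumFields.YangMills.Theorems.Prop7LineAvgRightInverse

variable {P : Params} {k : ℕ}

/-! ## §1 Separable sums over the offsets of a `k`-block -/

/-- **SEPARABLE SUMS OVER BLOCK OFFSETS**: a function of the `μ`-offset times a product of a profile over the other offsets sums to
`(Σ_s f(s))·(Σ_s φ(s))^{d−1}` over the offset cube `[0, L^k)^d`. [folklore] -/
theorem sum_offsets_mul_prod_erase (μ : Fin P.d) (f : Fin (P.L ^ k) → ℝ) (φ : ℕ → ℝ) :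
    ∑ r : Fin P.d → Fin (P.L ^ k), f (r μ) * ∏ ν ∈ univ.erase μ, φ (r ν)
      = (∑ s : Fin (P.L ^ k), f s) * (∑ s : Fin (P.L ^ k), φ s) ^ (P.d - 1) := by
  classical
  -- the summand as a product over all directions
  have hsplit : ∀ r : Fin P.d → Fin (P.L ^ k),
      f (r μ) * ∏ ν ∈ univ.erase μ, φ (r ν) = ∏ ν, (if ν = μ then f (r ν) else φ (r ν)) := by
    intro r
    rw [← Finset.mul_prod_erase univ (fun ν => if ν = μ then f (r ν) else φ (r ν)) (mem_univ μ)]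
    simp only [if_true]
    congr 1
    exact Finset.prod_congr rfl fun ν hν => by rw [if_neg (Finset.ne_of_mem_erase hν)]
  simp_rw [hsplit]
  rw [← Fintype.prod_sum (fun ν (s : Fin (P.L ^ k)) => if ν = μ then f s else φ s),
    ← Finset.mul_prod_erase univ _ (mem_univ μ)]
  simp only [if_true]
  congr 1
  rw [Finset.prod_congr rfl (fun ν hν => by rw [show (∑ s : Fin (P.L ^ k), if ν = μ then f s else φ s) = ∑ s : Fin (P.L ^ k), φ s from
      Finset.sum_congr rfl fun s _ => by rw [if_neg (Finset.ne_of_mem_erase hν)]]),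
    Finset.prod_const, Finset.card_erase_of_mem (mem_univ μ), Finset.card_univ, Fintype.card_fin]

/-! ## §2 The transversally modulated tent field and its (unchanged) normal operator -/

section Field

variable (h : P.sitesPerDir 0 = P.L ^ k * P.sitesPerDir k)
variable (ψ : ℕ → ℝ) (W : PBond P k → ℝ) (Z : PBond P 0 → ℝ)
  (hZ : ∀ b : PBond P 0, Z b = (((P.L : ℝ) ^ k) ^ P.d * (P.L : ℝ) ^ k)⁻¹ *
    (((((b.src b.dir).val % P.L ^ k : ℕ) : ℝ) + 1) * W ⟨Site.proj k k b.src, b.dir⟩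
      + ((P.L ^ k - 1 - (b.src b.dir).val % P.L ^ k : ℕ) : ℝ) * W ⟨(Site.proj k k b.src).unshift b.dir, b.dir⟩)
    * ∏ ν ∈ univ.erase b.dir, ψ ((b.src ν).val % P.L ^ k))
include h hZ

/-- The modulated tent field of a coarse bond field `W` (tent interpolation between `W(ȳ − e_μ)` and `W(ȳ)` along the block, times the
transversal profile `Π_{ν≠μ}ψ(r_ν)` of the offsets of the initial point), read on the block `B^k(y)`. [folklore] -/
theorem modField_fibreSite (y : Site P k) (μ : Fin P.d) (r : Fin P.d → Fin (P.L ^ k)) :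
    Z ⟨Site.fibreSite 0 k y r, μ⟩
      = (((P.L : ℝ) ^ k) ^ P.d * (P.L : ℝ) ^ k)⁻¹ *
        ((((r μ : ℕ) : ℝ) + 1) * W ⟨y, μ⟩ + ((P.L ^ k - 1 - (r μ : ℕ) : ℕ) : ℝ) * W ⟨y.unshift μ, μ⟩)
        * ∏ ν ∈ univ.erase μ, ψ (r ν) := by
  rw [hZ]
  simp only [val_fibreSite_mod _ h, Site.proj_fibreSite h]

/-- **THE NORMAL OPERATOR OF THE MODULATED FIELD IS THE TENT ONE**: for every profile `ψ` of block sum `Σ_{s<L^k}ψ(s) = L^k` (block mean `1`),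
`M_k Z (c) = (L^{kd}L^k)⁻²·(L^k)^{d−1}·(α·W(c) + γ·W(c − e_μ) + γ·W(c + e_μ))` with the tent moments `α = Σ_{s<L^k}((s+1)² + (L^k−1−s)²)`,
`γ = Σ_{s<L^k}(s+1)(L^k−1−s)` — the right-hand side of gen 3's `lineAvg_adjField` verbatim (the straight contours keep the transversal offsets, along
which the profile averages to `1`). [cite: Balaban1985Variational, (45)-(46) p.285] -/
theorem lineAvg_modField (hψ : ∑ s : Fin (P.L ^ k), ψ s = (P.L : ℝ) ^ k) (c : PBond P k) :
    (((P.L : ℝ) ^ k) ^ P.d * (P.L : ℝ) ^ k)⁻¹ *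
        ∑ x ∈ univ.filter (fun x : Site P 0 => Site.proj k k x = c.src), ∑ t ∈ range (P.L ^ k), Z ⟨(fun z : Site P 0 => z.shift c.dir)^[t] x, c.dir⟩
      = (((P.L : ℝ) ^ k) ^ P.d * (P.L : ℝ) ^ k)⁻¹ * ((((P.L ^ k : ℕ) : ℝ) ^ (P.d - 1)) *
          ((((P.L : ℝ) ^ k) ^ P.d * (P.L : ℝ) ^ k)⁻¹ *
            ((∑ s : Fin (P.L ^ k), ((((s : ℕ) : ℝ) + 1) ^ 2 + (((P.L ^ k - 1 - (s : ℕ) : ℕ) : ℝ)) ^ 2)) * W c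
              + (∑ s : Fin (P.L ^ k), (((s : ℕ) : ℝ) + 1) * ((P.L ^ k - 1 - (s : ℕ) : ℕ) : ℝ)) * W ⟨c.src.unshift c.dir, c.dir⟩
              + (∑ s : Fin (P.L ^ k), (((s : ℕ) : ℝ) + 1) * ((P.L ^ k - 1 - (s : ℕ) : ℕ) : ℝ)) * W ⟨runSite c.src c.dir 1, c.dir⟩))) := by
  have hpow : (∑ s : Fin (P.L ^ k), ψ s) ^ (P.d - 1) = (((P.L ^ k : ℕ) : ℝ) ^ (P.d - 1)) := by
    rw [hψ]; push_cast; ring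
  rw [lineAvg_eq_two_blocks h Z c]
  congr 1
  simp only [modField_fibreSite h ψ W Z hZ, unshift_runSite_one]
  set C₀ : ℝ := (((P.L : ℝ) ^ k) ^ P.d * (P.L : ℝ) ^ k)⁻¹ with hC₀
  have e1 : ∑ r : Fin P.d → Fin (P.L ^ k), (((r c.dir : ℕ) : ℝ) + 1) * (C₀ *
        ((((r c.dir : ℕ) : ℝ) + 1) * W ⟨c.src, c.dir⟩ + ((P.L ^ k - 1 - (r c.dir : ℕ) : ℕ) : ℝ) * W ⟨c.src.unshift c.dir, c.dir⟩)
        * ∏ ν ∈ univ.erase c.dir, ψ (r ν))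
      = (((P.L ^ k : ℕ) : ℝ) ^ (P.d - 1)) * ∑ s : Fin (P.L ^ k), (((s : ℕ) : ℝ) + 1) * (C₀ *
        ((((s : ℕ) : ℝ) + 1) * W ⟨c.src, c.dir⟩ + ((P.L ^ k - 1 - (s : ℕ) : ℕ) : ℝ) * W ⟨c.src.unshift c.dir, c.dir⟩)) := by
    have := sum_offsets_mul_prod_erase c.dir (fun s : Fin (P.L ^ k) => (((s : ℕ) : ℝ) + 1) * (C₀ *
        ((((s : ℕ) : ℝ) + 1) * W ⟨c.src, c.dir⟩ + ((P.L ^ k - 1 - (s : ℕ) : ℕ) : ℝ) * W ⟨c.src.unshift c.dir, c.dir⟩))) ψ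
    rw [hpow, mul_comm] at this
    rw [← this]
    exact Finset.sum_congr rfl fun r _ => by ring
  have e2 : ∑ r : Fin P.d → Fin (P.L ^ k), ((P.L ^ k - 1 - (r c.dir : ℕ) : ℕ) : ℝ) * (C₀ *
        ((((r c.dir : ℕ) : ℝ) + 1) * W ⟨runSite c.src c.dir 1, c.dir⟩ + ((P.L ^ k - 1 - (r c.dir : ℕ) : ℕ) : ℝ) * W ⟨c.src, c.dir⟩)
        * ∏ ν ∈ univ.erase c.dir, ψ (r ν))
      = (((P.L ^ k : ℕ) : ℝ) ^ (P.d - 1)) * ∑ s : Fin (P.L ^ k), ((P.L ^ k - 1 - (s : ℕ) : ℕ) : ℝ) * (C₀ *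
        ((((s : ℕ) : ℝ) + 1) * W ⟨runSite c.src c.dir 1, c.dir⟩ + ((P.L ^ k - 1 - (s : ℕ) : ℕ) : ℝ) * W ⟨c.src, c.dir⟩)) := by
    have := sum_offsets_mul_prod_erase c.dir (fun s : Fin (P.L ^ k) => ((P.L ^ k - 1 - (s : ℕ) : ℕ) : ℝ) * (C₀ *
        ((((s : ℕ) : ℝ) + 1) * W ⟨runSite c.src c.dir 1, c.dir⟩ + ((P.L ^ k - 1 - (s : ℕ) : ℕ) : ℝ) * W ⟨c.src, c.dir⟩))) ψ
    rw [hpow, mul_comm] at this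
    rw [← this]
    exact Finset.sum_congr rfl fun r _ => by ring
  have hc : (⟨c.src, c.dir⟩ : PBond P k) = c := rfl
  rw [hc] at e1 e2
  rw [e1, e2, ← mul_add, sum_tent_collect]

end Field

/-! ## §3 Block coordinates of a shifted fine site -/

section Shift

/-- Every fine site is the site of some offset in its own `k`-block. [folklore] -/
theorem eq_fibreSite_proj (h : P.sitesPerDir 0 = P.L ^ k * P.sitesPerDir k) (x : Site P 0) :
    ∃ r : Fin P.d → Fin (P.L ^ k), x = Site.fibreSite 0 k (Site.proj k k x) r := by
  refine ⟨Site.fibreEquiv h (Site.proj k k x) ⟨x, rfl⟩, ?_⟩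
  have := congrArg Subtype.val ((Site.fibreEquiv h (Site.proj k k x)).symm_apply_apply ⟨x, rfl⟩)
  exact this.symm

/-- A unit step INSIDE the block (offset `r_ρ + 1 < L^k`): same block, the `ρ`-offset increases by one. [folklore] -/
theorem fibreSite_shift_of_lt (y : Site P k) (r : Fin P.d → Fin (P.L ^ k)) (ρ : Fin P.d) (hr : (r ρ : ℕ) + 1 < P.L ^ k) :
    (Site.fibreSite 0 k y r).shift ρ = Site.fibreSite 0 k y (Function.update r ρ ⟨(r ρ : ℕ) + 1, hr⟩) := by
  funext ν
  by_cases hν : ν = ρ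
  · subst hν
    rw [shift_apply_self]
    simp only [Site.fibreSite, Function.update_self]
    push_cast
    ring
  · rw [shift_apply_ne _ hν]
    simp only [Site.fibreSite, Function.update_of_ne hν]

/-- A unit step ACROSS the block face (offset `r_ρ + 1 = L^k`): the block advances by `e_ρ`, the `ρ`-offset resets to `0`. [folklore] -/
theorem fibreSite_shift_of_eq (h : P.sitesPerDir 0 = P.L ^ k * P.sitesPerDir k) (y : Site P k) (r : Fin P.d → Fin (P.L ^ k)) (ρ : Fin P.d)
    (hr : (r ρ : ℕ) + 1 = P.L ^ k) :
    (Site.fibreSite 0 k y r).shift ρ = Site.fibreSite 0 k (y.shift ρ) (Function.update r ρ ⟨0, pow_pos P.L_pos k⟩) := by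
  rw [← runSite_one y ρ, fibreSite_runSite h y ρ 1, one_mul]
  funext ν
  by_cases hν : ν = ρ
  · subst hν
    rw [shift_apply_self, runSite_apply_self]
    simp only [Site.fibreSite, Function.update_self]
    have hc : ((r ν : ℕ) : ZMod (P.sitesPerDir 0)) + 1 = ((P.L ^ k : ℕ) : ZMod (P.sitesPerDir 0)) := by
      exact_mod_cast congrArg (Nat.cast (R := ZMod (P.sitesPerDir 0))) hr
    push_cast at hc ⊢
    linear_combination hc
  · rw [shift_apply_ne _ hν, runSite_apply_of_ne _ hν]
    simp only [Site.fibreSite, Function.update_of_ne hν]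

end Shift

end Summit.QuantumFields.YangMills.Theorems.Prop7LineAvgSmoothRightInverse

end
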